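/-
Copyright: the b2b-balaban T⁴-continuum CRUX team, row NE7b OWNER lineage `t4-ne7b-p1` (gen 122). Project licence.
-/
import Summits.QuantumFields.BalabanUV.T4Continuum.Spine.NE7b.SupTorusPointwiseRoadColumn

/-!
# THE PROPAGATOR OF THE TORUS ROAD IS VOLUME-INDEPENDENT UP TO `e^{−δs}`: for two tori of coarse periods `s ∣ st` (covering maps `πf`, `πc`
# reading the same lattice representatives) and a periodic potential `V∘πf` on the road's class, the solution `U` on the LARGE torus for a
# source placed in ONE block `ŷ₀` and the solution `u` on the SMALL torus for the same source (at the block `πc ŷ₀`) satisfy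
# `|U(x) − u(πf x)| ≤ C·‖f‖_∞·e^{2δρ_{st}(bt x, ŷ₀)}·e^{−δs}` at EVERY site of the large torus, `d ≥ 3` — `u∘πf` IS the superposition of the
# large-torus solutions over the `t^d` deck translates of the source (lifting + uniqueness), every translate other than `ŷ₀` is `≥ s`
# coarse blocks away, and (155) `propagator_pointwise_decay_road` makes its contribution `e^{−δ₁·(distance)}` (row NE7b, node U5c; the
# volume half of § [NE7bP1-G121-HANDOFF] NEXT (3)(e); (133)∕(148)∕(155) BY NAME; [folklore])

Cell `pub-balaban`, sub-cell `t4`, spine estimate NE7b (`T4WeightBudget.RelWeightBound`; the cell's OWN estimate — NOT PRINTED in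
[Bałaban 1983–89], NOT PROVED).  Crux-route work under `Spine/NE7b/` by the row OWNER (`t4-ne7b-p1` gen 122, file (158)) under FREEZE
(0)'s crux-prover clause; NOTHING of Bałaban's is named as a Lean object, valued or asserted; no `T4Continuum/Support` leaf typed; no `def`,
no notation (the action DISPLAYED on both tori; the covering maps `πf : Site d ((n+1)st) → Site d ((n+1)s)`, `πc : Site d (st) → Site d s`
enter through their DISPLAYED action on representatives, `π(σ q) = σ q`); zero `sorry`.  Imports (BY NAME): the OWNER's (155)
`…SupTorusPointwiseRoadColumn` (`propagator_pointwise_decay_road`; through it (148) `action_surjective`, (133) `action_injective`,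
`action_sum_smul`, (132) `isPseudoDist_torus`, `torus_sum_exp_le`, the torus dictionary `siteOf_windowMap`, `exists_windowMap_siteOf`,
`blockOf_siteOf`, `blk_translate`, `sum_B_translate`, `comp_siteOf_periodic`, `natCast_mul_smul_eq`).

WHY (located).  § [NE7bP1-G121-HANDOFF] (3)(e) asks for the thermodynamic limit `s → ∞` of the road's `ℓ²` objects; its content is that
the finite-volume objects stop depending on the volume exponentially fast.  Between two tori `s ∣ st` this is ALGEBRA plus (155): the
displayed action commutes with the covering map (§1 `action_lift`: `H_{st}[V∘πf](u∘πf) = (H_s[V]u)∘πf`, the block term because blocks of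
representatives of one class are period translates and `u∘σ` is periodic), so by uniqueness ((133) `action_injective`) `u∘πf` is the
superposition `Σ_{πc ŷ = πc ŷ₀} U^{(ŷ)}` of the large-torus solutions `U^{(ŷ)}` of the source placed at the deck translates `ŷ` (§2), and
`U = U^{(ŷ₀)}`; two distinct translates are `≥ s` apart in `ρ_{st}` (§1 `translate_dist`: their coordinate differences are nonzero
multiples of `s`, read on the centred representative), so `|U(x) − u(πf x)| ≤ Σ_{ŷ ≠ ŷ₀} C₁Me^{−δ₁ρ(bt x, ŷ)} ≤ C₁M·e^{δ₁ρ(bt x, ŷ₀)}·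
e^{−(δ₁∕2)s}·Σ_ŷ e^{−(δ₁∕2)ρ(ŷ,ŷ₀)}` ((132) `torus_sum_exp_le`).

WHAT IS PROVED ([folklore]; small tori `Site d ((n+1)s)` ∕ `Site d s`, large tori `Site d ((n+1)(st))` ∕ `Site d (st)`, `[NeZero s]`,
`[NeZero t]`; `σ = siteOf`, `bt x = σ(blk n (wm x))` on either torus; `πf`, `πc` ANY maps with `π(σ q) = σ q` for all `q ∈ ℤ^d`):
* §1 `cover_eq` (`πf x = σ_s(wm_{st} x)`), `bt_cover` (`πc(bt_{st} x) = bt_s(πf x)`), **`action_lift`** (the displayed action on the large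
  torus of `u∘πf` with potential `V∘πf` at `x` equals the displayed action of `u` with `V` at `πf x`), **`translate_dist`** (`ŷ ≠ ŷ′`,
  `πc ŷ = πc ŷ′` ⟹ `s ≤ ρ_{st}(ŷ, ŷ′)`).
* §2 `deck_sum_exp_le` (`Σ_{ŷ ≠ ŷ₀, πc ŷ = πc ŷ₀} e^{−2δρ(y_x, ŷ)} ≤ e^{2δρ(y_x, ŷ₀)}·e^{−δs}·K_δ` for every block `y_x`).
* §3 THE HEADLINE **`volume_comparison`**: `d ≥ 3`, `a > 0`, `λ < min(2,a)`, `Λ ≥ 0` ⟹ `∃ C δ > 0`: for ALL `n, s, t`, ALL covering maps,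
  ALL `−λ ≤ V ≤ Λ` on the small torus, every block `ŷ₀` of the large coarse torus, every `f` on the small torus supported in the block
  `πc ŷ₀` with `|f| ≤ M`, every small solution `H_s[V]u = f` and every large solution `H_{st}[V∘πf]U = 𝟙[bt · = ŷ₀]·(f∘πf)`:
  `|U x − u(πf x)| ≤ C·M·e^{2δρ_{st}(bt x, ŷ₀)}·e^{−δs}` at EVERY site `x` of the large torus.
* §4 toy (`d = 3`).

HONEST (what this is NOT).  Two commensurable tori, not `ℤ^d` (the `ℓ²(ℤ^d)` twin of (89) is not built); periodic potentials only (the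
road's `V = u″∘φ_s` depends on the volume through the background — its own volume dependence is (88)'s, in the sup currency, not
junctioned here); `d ≥ 3`; constants existential and far from sharp; cubic periods; scalar skeleton ((A3), NC-NE7b-α UNRULED); nothing of
Bałaban's.  BY-NAME EFFECT ON THE WALL: NONE.  NE7b NOT PRINTED ∕ NOT PROVED; spine PROVED 0∕9; rung (B)+1 on a FINITE torus — NOT
infinite volume, NOT the mass gap, NOT Clay.  HONEST DEPENDENCY: continuum YM on T⁴ ⇐ BetaPertH ∧ nine spine estimates (0∕9 proved);
BetaPertH ⇐ (D1) ∧ (D4) ∧ CAP+tail; G-an2-4 gates asym, D1 and NE2∕3∕4.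
-/

set_option autoImplicit false

noncomputable section

namespace Summit.QuantumFields.BalabanUV.T4Continuum.NE7b.SupTorusVolumeComparison

open Real
open Literature.MathematicalPhysics.QuantumFieldTheory.Balaban1983to89
open B6QGQLower276 (X e blk B side chart mem_B sum_B sum_B_const card_cube blk_chart)
open Beta (Site siteOf windowMap siteOf_windowMap siteOf_add siteOf_sub)
open SupTorusDirichletForm (blockOf_siteOf blockOf_siteOf_of_mem)
open SupTorusDirichletFormCoercive (comp_siteOf_periodic)
open PeriodicSupTorusCarrier (exists_windowMap_siteOf natCast_mul_smul_eq)
open OneShotChartTorusRowsZd (blk_translate sum_B_translate)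
open SupTorusBlockDistance (isPseudoDist_torus torus_sum_exp_le)
open SupTorusActionForm (action_injective action_sum_smul)
open SupTorusSupNormBound (action_surjective)
open SupTorusPointwiseRoadColumn (propagator_pointwise_decay_road)

variable {d : ℕ}

/-! ## §1. Covering maps read on representatives: the action lifts, deck translates are far apart -/

section Cover

variable (n s t : ℕ) [NeZero s] [NeZero t]
  (πf : Site d ((n + 1) * (s * t)) → Site d ((n + 1) * s)) (πc : Site d (s * t) → Site d s)
  (hπf : ∀ q : X d, πf (siteOf d ((n + 1) * (s * t)) q) = siteOf d ((n + 1) * s) q)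
  (hπc : ∀ b : X d, πc (siteOf d (s * t) b) = siteOf d s b)

include hπf in
/-- The fine covering map reads the window representative: `πf x = σ_s(wm_{st} x)`. [folklore] -/
theorem cover_eq (x : Site d ((n + 1) * (s * t))) : πf x = siteOf d ((n + 1) * s) (windowMap d ((n + 1) * (s * t)) x) := by
  conv_lhs => rw [← siteOf_windowMap d ((n + 1) * (s * t)) x]
  exact hπf _

include hπf hπc in
/-- **THE BLOCK MAPS COMMUTE WITH THE COVERING**: `πc(bt_{st} x) = bt_s(πf x)`. [folklore] -/
theorem bt_cover (x : Site d ((n + 1) * (s * t))) :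
    πc (siteOf d (s * t) (blk n (windowMap d ((n + 1) * (s * t)) x)))
      = siteOf d s (blk n (windowMap d ((n + 1) * s) (πf x))) := by
  rw [hπc, cover_eq n s t πf hπf x, blockOf_siteOf]

include hπf in
/-- **THE DISPLAYED ACTION LIFTS ALONG THE COVERING**: for every `u, V` on the small fine torus and every site `x` of the large one, the
displayed action of `u∘πf` with the potential `V∘πf` at `x` equals the displayed action of `u` with `V` at `πf x` — the Laplacian terms by
`π(σq ± ê) = σq ± ê`, the block term because the blocks of two representatives of one class are period translates and `u∘σ` is periodic.
[folklore] -/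
theorem action_lift (a : ℝ) (u V : Site d ((n + 1) * s) → ℝ) (x : Site d ((n + 1) * (s * t))) :
    ((n : ℝ) + 1) ^ 2 * ∑ μ, (2 * u (πf x) - u (πf (x + siteOf d ((n + 1) * (s * t)) (e μ))) - u (πf (x - siteOf d ((n + 1) * (s * t)) (e μ))))
        + a / ((n : ℝ) + 1) ^ d * ∑ q ∈ B n (blk n (windowMap d ((n + 1) * (s * t)) x)), u (πf (siteOf d ((n + 1) * (s * t)) q))
        + V (πf x) * u (πf x)
      = ((n : ℝ) + 1) ^ 2 * ∑ μ, (2 * u (πf x) - u (πf x + siteOf d ((n + 1) * s) (e μ)) - u (πf x - siteOf d ((n + 1) * s) (e μ)))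
        + a / ((n : ℝ) + 1) ^ d * ∑ q ∈ B n (blk n (windowMap d ((n + 1) * s) (πf x))), u (siteOf d ((n + 1) * s) q)
        + V (πf x) * u (πf x) := by
  set q₀ : X d := windowMap d ((n + 1) * (s * t)) x with hq₀
  have hx : x = siteOf d ((n + 1) * (s * t)) q₀ := (siteOf_windowMap d ((n + 1) * (s * t)) x).symm
  have hπx : πf x = siteOf d ((n + 1) * s) q₀ := cover_eq n s t πf hπf x
  -- the Laplacian terms
  have hplus : ∀ μ, πf (x + siteOf d ((n + 1) * (s * t)) (e μ)) = πf x + siteOf d ((n + 1) * s) (e μ) := fun μ => by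
    rw [hπx]; conv_lhs => rw [hx, ← siteOf_add, hπf]
    rw [siteOf_add]
  have hminus : ∀ μ, πf (x - siteOf d ((n + 1) * (s * t)) (e μ)) = πf x - siteOf d ((n + 1) * s) (e μ) := fun μ => by
    rw [hπx]; conv_lhs => rw [hx, ← siteOf_sub, hπf]
    rw [siteOf_sub]
  simp only [hplus, hminus, hπf]
  -- the block term: the small window representative of `πf x` is a period translate of `q₀`
  obtain ⟨m, hm⟩ := exists_windowMap_siteOf ((n + 1) * s) q₀
  have hblk : blk n (windowMap d ((n + 1) * s) (πf x)) = blk n q₀ + (s : ℤ) • m := by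
    rw [hπx, hm, natCast_mul_smul_eq, blk_translate]
  have hsum : ∑ q ∈ B n (blk n (windowMap d ((n + 1) * s) (πf x))), u (siteOf d ((n + 1) * s) q)
      = ∑ q ∈ B n (blk n q₀), u (siteOf d ((n + 1) * s) q) := by
    rw [hblk, sum_B_translate]
    exact Finset.sum_congr rfl fun q _ => comp_siteOf_periodic n s u q m
  rw [hsum]

omit [NeZero s] [NeZero t] in
include hπc in
/-- **DISTINCT DECK TRANSLATES ARE `≥ s` APART**: `ŷ ≠ ŷ′` with `πc ŷ = πc ŷ′` ⟹ `s ≤ ρ_{st}(ŷ, ŷ′)` — some coordinate difference is a NONZERO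
multiple of `s`, read on its centred representative (`ZMod.coe_valMinAbs`). [folklore] -/
theorem translate_dist [NeZero (s * t)] (y y' : Site d (s * t)) (hne : y ≠ y') (hπ : πc y = πc y') :
    (s : ℝ) ≤ ∑ i, (((y i - y' i).valMinAbs.natAbs : ℕ) : ℝ) := by
  classical
  -- representatives
  set b : X d := windowMap d (s * t) y with hb
  set b' : X d := windowMap d (s * t) y' with hb'
  have hy : y = siteOf d (s * t) b := (siteOf_windowMap d (s * t) y).symm
  have hy' : y' = siteOf d (s * t) b' := (siteOf_windowMap d (s * t) y').symm
  have hdvd : ∀ i, (s : ℤ) ∣ b i - b' i := fun i => by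
    have h1 : siteOf d s b = siteOf d s b' := by rw [← hπc b, ← hπc b', ← hy, ← hy', hπ]
    have h2 : ((b i : ℤ) : ZMod s) = ((b' i : ℤ) : ZMod s) := congrFun h1 i
    have h3 := (ZMod.intCast_eq_intCast_iff_dvd_sub (b' i) (b i) s).1 h2.symm
    exact h3
  -- a coordinate where they differ
  obtain ⟨i, hi⟩ : ∃ i, y i ≠ y' i := Function.ne_iff.1 hne
  have hv0 : (y i - y' i).valMinAbs ≠ 0 := fun h => hi (sub_eq_zero.1 ((ZMod.valMinAbs_eq_zero _).1 h))
  -- `s ∣ valMinAbs (y i − y′ i)`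
  have hsv : (s : ℤ) ∣ (y i - y' i).valMinAbs := by
    have h1 : (((y i - y' i).valMinAbs : ℤ) : ZMod (s * t)) = ((b i - b' i : ℤ) : ZMod (s * t)) := by
      rw [ZMod.coe_valMinAbs, hy, hy']; simp [siteOf, Int.cast_sub]
    have h2 : ((s * t : ℕ) : ℤ) ∣ (b i - b' i) - (y i - y' i).valMinAbs := (ZMod.intCast_eq_intCast_iff_dvd_sub _ _ _).1 h1
    have hst : (s : ℤ) ∣ ((s * t : ℕ) : ℤ) := ⟨(t : ℤ), by push_cast; ring⟩
    have h3 : (s : ℤ) ∣ (b i - b' i) - (y i - y' i).valMinAbs := hst.trans h2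
    have h4 := (Int.dvd_sub (hdvd i) h3)
    rwa [sub_sub_cancel] at h4
  have hle : s ≤ (y i - y' i).valMinAbs.natAbs := by
    have := Int.natAbs_dvd_natAbs.2 hsv
    rw [Int.natAbs_natCast] at this
    exact Nat.le_of_dvd (Int.natAbs_pos.2 hv0) this
  calc (s : ℝ) ≤ (((y i - y' i).valMinAbs.natAbs : ℕ) : ℝ) := by exact_mod_cast hle
    _ ≤ ∑ j, (((y j - y' j).valMinAbs.natAbs : ℕ) : ℝ) :=
        Finset.single_le_sum (f := fun j => (((y j - y' j).valMinAbs.natAbs : ℕ) : ℝ)) (fun _ _ => Nat.cast_nonneg _) (Finset.mem_univ i)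

end Cover

/-! ## §2. Deck sums -/

section Deck

variable (s t : ℕ) [NeZero s] [NeZero t]

/-- **THE FAR DECK TRANSLATES SUM TO `e^{−δs}·K_δ` AGAINST THE PROFILE AT `x`**: for `ŷ₀` and a block `yx` of the large coarse torus,
`Σ_{ŷ ≠ ŷ₀, πc ŷ = πc ŷ₀} e^{−2δρ(yx, ŷ)} ≤ e^{2δρ(yx, ŷ₀)}·e^{−δs}·(2∕(1 − e^{−δ}))^d` (triangle inequality, §1 `translate_dist`, (132)
`torus_sum_exp_le`). [folklore] -/
theorem deck_sum_exp_le (πc : Site d (s * t) → Site d s) (hπc : ∀ b : X d, πc (siteOf d (s * t) b) = siteOf d s b)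
    {δ : ℝ} (hδ : 0 < δ) (ŷ₀ yx : Site d (s * t)) :
    ∑ ŷ : Site d (s * t), (if ŷ ≠ ŷ₀ ∧ πc ŷ = πc ŷ₀ then exp (-(2 * δ * ∑ i, (((yx i - ŷ i).valMinAbs.natAbs : ℕ) : ℝ))) else 0)
      ≤ exp (2 * δ * ∑ i, (((yx i - ŷ₀ i).valMinAbs.natAbs : ℕ) : ℝ)) * exp (-(δ * s)) * (2 * (1 - exp (-δ))⁻¹) ^ d := by
  classical
  have hP := isPseudoDist_torus (d := d) (s * t)
  have hK := torus_sum_exp_le (d := d) (s * t) hδ ŷ₀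
  have hterm : ∀ ŷ : Site d (s * t),
      (if ŷ ≠ ŷ₀ ∧ πc ŷ = πc ŷ₀ then exp (-(2 * δ * ∑ i, (((yx i - ŷ i).valMinAbs.natAbs : ℕ) : ℝ))) else 0)
        ≤ exp (2 * δ * ∑ i, (((yx i - ŷ₀ i).valMinAbs.natAbs : ℕ) : ℝ)) * exp (-(δ * s))
          * exp (-(δ * ∑ i, (((ŷ₀ i - ŷ i).valMinAbs.natAbs : ℕ) : ℝ))) := by
    intro ŷ
    split_ifs with h
    · have hfar : (s : ℝ) ≤ ∑ i, (((ŷ i - ŷ₀ i).valMinAbs.natAbs : ℕ) : ℝ) := translate_dist s t πc hπc ŷ ŷ₀ h.1 h.2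
      have htri : ∑ i, (((ŷ₀ i - ŷ i).valMinAbs.natAbs : ℕ) : ℝ)
          ≤ ∑ i, (((ŷ₀ i - yx i).valMinAbs.natAbs : ℕ) : ℝ) + ∑ i, (((yx i - ŷ i).valMinAbs.natAbs : ℕ) : ℝ) := hP.triangle ŷ₀ yx ŷ
      have hs1 : ∑ i, (((ŷ₀ i - yx i).valMinAbs.natAbs : ℕ) : ℝ) = ∑ i, (((yx i - ŷ₀ i).valMinAbs.natAbs : ℕ) : ℝ) := hP.symm ŷ₀ yx
      have hs2 : ∑ i, (((ŷ i - ŷ₀ i).valMinAbs.natAbs : ℕ) : ℝ) = ∑ i, (((ŷ₀ i - ŷ i).valMinAbs.natAbs : ℕ) : ℝ) := hP.symm ŷ ŷ₀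
      rw [hs1] at htri
      rw [hs2] at hfar
      rw [← exp_add, ← exp_add]
      refine exp_le_exp.2 ?_
      nlinarith [hδ, htri, hfar]
    · positivity
  calc ∑ ŷ : Site d (s * t), (if ŷ ≠ ŷ₀ ∧ πc ŷ = πc ŷ₀ then exp (-(2 * δ * ∑ i, (((yx i - ŷ i).valMinAbs.natAbs : ℕ) : ℝ))) else 0)
      ≤ ∑ ŷ : Site d (s * t), exp (2 * δ * ∑ i, (((yx i - ŷ₀ i).valMinAbs.natAbs : ℕ) : ℝ)) * exp (-(δ * s))
          * exp (-(δ * ∑ i, (((ŷ₀ i - ŷ i).valMinAbs.natAbs : ℕ) : ℝ))) := Finset.sum_le_sum fun ŷ _ => hterm ŷ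
    _ = exp (2 * δ * ∑ i, (((yx i - ŷ₀ i).valMinAbs.natAbs : ℕ) : ℝ)) * exp (-(δ * s))
          * ∑ ŷ : Site d (s * t), exp (-(δ * ∑ i, (((ŷ₀ i - ŷ i).valMinAbs.natAbs : ℕ) : ℝ))) := (Finset.mul_sum _ _ _).symm
    _ ≤ _ := mul_le_mul_of_nonneg_left hK (by positivity)

end Deck

/-! ## §3. THE END: the propagators of two commensurable volumes agree up to `e^{−δs}` -/

/-- **HEADLINE — VOLUME INDEPENDENCE OF THE PROPAGATOR UP TO `e^{−δs}`, `d ≥ 3`.**  `∃ C δ > 0` (from `(d, a, λ, Λ)` and `C(d)`) such that for ALL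
`n, s, t`, ALL covering maps `πf, πc` reading representatives, ALL small potentials `−λ ≤ V ≤ Λ`, every block `ŷ₀` of the large coarse torus,
every small source `f` supported in the block `πc ŷ₀` with `|f| ≤ M`, every small solution `H_s[V]u = f` and every large solution
`H_{st}[V∘πf]U = 𝟙[bt · = ŷ₀]·(f∘πf)`: `|U x − u(πf x)| ≤ C·M·e^{2δρ_{st}(bt x, ŷ₀)}·e^{−δs}` at EVERY large site `x` — within `o(s)` blocks of the
source the two volumes give the same propagator up to `e^{−δs}`.  § [NE7bP1-G121-HANDOFF] NEXT (3)(e), commensurable-volume half. [folklore] -/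
theorem volume_comparison (hd : 3 ≤ d) (a : ℝ) (ha : 0 < a) {lam Lam : ℝ} (hlam : lam < min 2 a) (hLam : 0 ≤ Lam) :
    ∃ C δ : ℝ, 0 < C ∧ 0 < δ ∧ ∀ (n s t : ℕ) [NeZero s] [NeZero t]
      (πf : Site d ((n + 1) * (s * t)) → Site d ((n + 1) * s)) (πc : Site d (s * t) → Site d s),
      (∀ q : X d, πf (siteOf d ((n + 1) * (s * t)) q) = siteOf d ((n + 1) * s) q) →
      (∀ b : X d, πc (siteOf d (s * t) b) = siteOf d s b) →
      ∀ (V : Site d ((n + 1) * s) → ℝ), (∀ x, -lam ≤ V x) → (∀ x, V x ≤ Lam) →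
      ∀ (ŷ₀ : Site d (s * t)) (M : ℝ) (f : Site d ((n + 1) * s) → ℝ),
      (∀ x, siteOf d s (blk n (windowMap d ((n + 1) * s) x)) ≠ πc ŷ₀ → f x = 0) → (∀ x, |f x| ≤ M) →
      ∀ (u : Site d ((n + 1) * s) → ℝ),
      (∀ x, ((n : ℝ) + 1) ^ 2 * ∑ μ, (2 * u x - u (x + siteOf d ((n + 1) * s) (e μ)) - u (x - siteOf d ((n + 1) * s) (e μ)))
        + a / ((n : ℝ) + 1) ^ d * ∑ q ∈ B n (blk n (windowMap d ((n + 1) * s) x)), u (siteOf d ((n + 1) * s) q) + V x * u x = f x) →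
      ∀ (U : Site d ((n + 1) * (s * t)) → ℝ),
      (∀ x, ((n : ℝ) + 1) ^ 2 * ∑ μ, (2 * U x - U (x + siteOf d ((n + 1) * (s * t)) (e μ)) - U (x - siteOf d ((n + 1) * (s * t)) (e μ)))
        + a / ((n : ℝ) + 1) ^ d * ∑ q ∈ B n (blk n (windowMap d ((n + 1) * (s * t)) x)), U (siteOf d ((n + 1) * (s * t)) q)
        + V (πf x) * U x
        = if siteOf d (s * t) (blk n (windowMap d ((n + 1) * (s * t)) x)) = ŷ₀ then f (πf x) else 0) →
      ∀ x : Site d ((n + 1) * (s * t)),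
        |U x - u (πf x)| ≤ C * M * exp (2 * δ * ∑ i, ((((siteOf d (s * t) (blk n (windowMap d ((n + 1) * (s * t)) x))) i
            - ŷ₀ i).valMinAbs.natAbs : ℕ) : ℝ)) * exp (-(δ * s)) := by
  classical
  have hm0 : 0 < min 2 a - lam := by linarith
  obtain ⟨C₁, δ₁, hC₁, hδ₁, H155⟩ := propagator_pointwise_decay_road (d := d) hd a ha hlam hLam
  set δ : ℝ := δ₁ / 2 with hδ_def
  have hδ0 : 0 < δ := by positivity
  set K : ℝ := (2 * (1 - exp (-δ))⁻¹) ^ d with hK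
  have hK0 : 0 ≤ K := pow_nonneg (mul_nonneg zero_le_two (inv_nonneg.2 (sub_nonneg.2 (exp_le_one_iff.2 (by linarith))))) d
  refine ⟨C₁ * K + 1, δ, by positivity, hδ0, ?_⟩
  intro n s t _ _ πf πc hπf hπc V hV hV' ŷ₀ M f hf hfM u hu U hU x
  have hM : 0 ≤ M := (abs_nonneg _).trans (hfM (πf x))
  -- the large potential is in the class
  have hW : ∀ x', -lam ≤ V (πf x') := fun x' => hV _
  have hW' : ∀ x', V (πf x') ≤ Lam := fun x' => hV' _
  -- the translated block sources and their solutions on the large torus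
  have hsol := fun ŷ : Site d (s * t) => action_surjective n a (s * t) ha.le hm0 (fun x' => V (πf x')) hW
    (fun x' => if siteOf d (s * t) (blk n (windowMap d ((n + 1) * (s * t)) x')) = ŷ then f (πf x') else 0)
  choose Uy hUy using hsol
  -- each is pointwise local around its block: `|U^{(ŷ)} x| ≤ C₁M·e^{−δ₁ρ(bt x, ŷ)}`
  have hloc : ∀ ŷ : Site d (s * t), |Uy ŷ x| ≤ C₁ * M
      * exp (-(δ₁ * ∑ i, ((((siteOf d (s * t) (blk n (windowMap d ((n + 1) * (s * t)) x))) i - ŷ i).valMinAbs.natAbs : ℕ) : ℝ))) := by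
    intro ŷ
    have h := H155 n (s * t) (fun x' => V (πf x')) hW hW' ŷ M (Uy ŷ)
      (fun x' => if siteOf d (s * t) (blk n (windowMap d ((n + 1) * (s * t)) x')) = ŷ then f (πf x') else 0)
      (fun x' hx' => by simp only [if_neg hx']) (fun x' => by
        by_cases hx' : siteOf d (s * t) (blk n (windowMap d ((n + 1) * (s * t)) x')) = ŷ
        · simp only [if_pos hx']; exact hfM _
        · simp only [if_neg hx', abs_zero]; exact hM) (hUy ŷ) x
    rw [exp_neg, ← div_eq_mul_inv, le_div_iff₀ (exp_pos _), mul_comm]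
    exact h
  -- the deck superposition solves the lifted equation, as does `u∘πf`: they coincide
  set Usum : Site d ((n + 1) * (s * t)) → ℝ := fun x' => ∑ ŷ : Site d (s * t), (if πc ŷ = πc ŷ₀ then (1 : ℝ) else 0) * Uy ŷ x'
    with hUsum
  have hHsum : ∀ x', ((n : ℝ) + 1) ^ 2 * ∑ μ, (2 * Usum x' - Usum (x' + siteOf d ((n + 1) * (s * t)) (e μ)) - Usum (x' - siteOf d ((n + 1) * (s * t)) (e μ)))
      + a / ((n : ℝ) + 1) ^ d * ∑ q ∈ B n (blk n (windowMap d ((n + 1) * (s * t)) x')), Usum (siteOf d ((n + 1) * (s * t)) q)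
      + V (πf x') * Usum x' = f (πf x') := by
    intro x'
    simp only [hUsum]
    rw [action_sum_smul n a (s * t) Finset.univ (fun ŷ => if πc ŷ = πc ŷ₀ then (1 : ℝ) else 0) Uy (fun x' => V (πf x')) x']
    simp only [hUy]
    rw [Finset.sum_eq_single (siteOf d (s * t) (blk n (windowMap d ((n + 1) * (s * t)) x')))]
    · rw [if_pos rfl]
      by_cases hb : πc (siteOf d (s * t) (blk n (windowMap d ((n + 1) * (s * t)) x'))) = πc ŷ₀
      · rw [if_pos hb, one_mul]
      · rw [if_neg hb, zero_mul]
        rw [bt_cover n s t πf πc hπf hπc x'] at hb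
        exact (hf (πf x') hb).symm
    · intro ŷ _ hŷ; rw [if_neg (Ne.symm hŷ), mul_zero]
    · intro h; exact absurd (Finset.mem_univ _) h
  have hHlift : ∀ x', ((n : ℝ) + 1) ^ 2 * ∑ μ, (2 * u (πf x') - u (πf (x' + siteOf d ((n + 1) * (s * t)) (e μ)))
        - u (πf (x' - siteOf d ((n + 1) * (s * t)) (e μ))))
      + a / ((n : ℝ) + 1) ^ d * ∑ q ∈ B n (blk n (windowMap d ((n + 1) * (s * t)) x')), u (πf (siteOf d ((n + 1) * (s * t)) q))
      + V (πf x') * u (πf x') = f (πf x') := fun x' => by rw [action_lift n s t πf hπf a u V x', hu (πf x')]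
  have heq : (fun x' => u (πf x')) = Usum :=
    action_injective n a (s * t) ha.le hm0 (fun x' => V (πf x')) hW (fun x' => u (πf x')) Usum fun x' => by rw [hHlift x', hHsum x']
  -- `U = U^{(ŷ₀)}`
  have hU0 : U = Uy ŷ₀ := action_injective n a (s * t) ha.le hm0 (fun x' => V (πf x')) hW U (Uy ŷ₀) fun x' => by rw [hU x', hUy ŷ₀ x']
  -- the difference is the sum over the far translates
  have hdiff : U x - u (πf x) = -∑ ŷ : Site d (s * t), (if ŷ ≠ ŷ₀ ∧ πc ŷ = πc ŷ₀ then (1 : ℝ) else 0) * Uy ŷ x := by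
    have h1 : u (πf x) = Usum x := congrFun heq x
    rw [h1, hU0, hUsum]
    simp only
    rw [← Finset.add_sum_erase Finset.univ _ (Finset.mem_univ ŷ₀), if_pos rfl, one_mul,
      ← Finset.add_sum_erase Finset.univ (fun ŷ => (if ŷ ≠ ŷ₀ ∧ πc ŷ = πc ŷ₀ then (1 : ℝ) else 0) * Uy ŷ x) (Finset.mem_univ ŷ₀)]
    simp only [ne_eq, not_true_eq_false, false_and, if_false, zero_mul, zero_add]
    have h2 : ∑ ŷ ∈ Finset.univ.erase ŷ₀, (if πc ŷ = πc ŷ₀ then (1 : ℝ) else 0) * Uy ŷ x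
        = ∑ ŷ ∈ Finset.univ.erase ŷ₀, (if ¬ŷ = ŷ₀ ∧ πc ŷ = πc ŷ₀ then (1 : ℝ) else 0) * Uy ŷ x :=
      Finset.sum_congr rfl fun ŷ hŷ => by rw [Finset.mem_erase] at hŷ; simp only [hŷ.1, not_false_eq_true, true_and]
    rw [h2]; ring
  rw [hdiff, abs_neg]
  have hP := isPseudoDist_torus (d := d) (s * t)
  calc |∑ ŷ : Site d (s * t), (if ŷ ≠ ŷ₀ ∧ πc ŷ = πc ŷ₀ then (1 : ℝ) else 0) * Uy ŷ x|
      ≤ ∑ ŷ : Site d (s * t), |(if ŷ ≠ ŷ₀ ∧ πc ŷ = πc ŷ₀ then (1 : ℝ) else 0) * Uy ŷ x| := Finset.abs_sum_le_sum_abs _ _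
    _ ≤ ∑ ŷ : Site d (s * t), C₁ * M * (if ŷ ≠ ŷ₀ ∧ πc ŷ = πc ŷ₀ then
          exp (-(2 * δ * ∑ i, ((((siteOf d (s * t) (blk n (windowMap d ((n + 1) * (s * t)) x))) i - ŷ i).valMinAbs.natAbs : ℕ) : ℝ)))
          else 0) := by
        refine Finset.sum_le_sum fun ŷ _ => ?_
        split_ifs with h
        · rw [one_mul, show 2 * δ = δ₁ by rw [hδ_def]; ring]; exact hloc ŷ
        · rw [zero_mul, abs_zero, mul_zero]
    _ = C₁ * M * ∑ ŷ : Site d (s * t), (if ŷ ≠ ŷ₀ ∧ πc ŷ = πc ŷ₀ then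
          exp (-(2 * δ * ∑ i, ((((siteOf d (s * t) (blk n (windowMap d ((n + 1) * (s * t)) x))) i - ŷ i).valMinAbs.natAbs : ℕ) : ℝ)))
          else 0) := (Finset.mul_sum _ _ _).symm
    _ ≤ C₁ * M * (exp (2 * δ * ∑ i, ((((siteOf d (s * t) (blk n (windowMap d ((n + 1) * (s * t)) x))) i - ŷ₀ i).valMinAbs.natAbs : ℕ) : ℝ))
          * exp (-(δ * s)) * K) :=
        mul_le_mul_of_nonneg_left (deck_sum_exp_le s t πc hπc hδ0 ŷ₀ _) (by positivity)
    _ = C₁ * K * M * exp (2 * δ * ∑ i, ((((siteOf d (s * t) (blk n (windowMap d ((n + 1) * (s * t)) x))) i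
          - ŷ₀ i).valMinAbs.natAbs : ℕ) : ℝ)) * exp (-(δ * s)) := by ring
    _ ≤ (C₁ * K + 1) * M * exp (2 * δ * ∑ i, ((((siteOf d (s * t) (blk n (windowMap d ((n + 1) * (s * t)) x))) i
          - ŷ₀ i).valMinAbs.natAbs : ℕ) : ℝ)) * exp (-(δ * s)) := by
        have : (0 : ℝ) ≤ M * exp (2 * δ * ∑ i, ((((siteOf d (s * t) (blk n (windowMap d ((n + 1) * (s * t)) x))) i
            - ŷ₀ i).valMinAbs.natAbs : ℕ) : ℝ)) * exp (-(δ * s)) := by positivity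
        nlinarith

/-! ## §4. Toy -/

/-- Toy (`d = 3`, `a = 1`, `λ = 0`, `Λ = 1`): the constants exist. -/
example : ∃ C δ : ℝ, 0 < C ∧ 0 < δ :=
  let ⟨C, δ, hC, hδ, _⟩ := volume_comparison (d := 3) le_rfl 1 one_pos (lam := 0) (Lam := 1) (by norm_num) zero_le_one
  ⟨C, δ, hC, hδ⟩

end Summit.QuantumFields.BalabanUV.T4Continuum.NE7b.SupTorusVolumeComparison
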